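import Mathlib
import Summits.Ventures.PercRepro2.Defs
import Summits.Ventures.PercRepro2.Independence
import Summits.Ventures.PercRepro2.Harris
import Summits.Ventures.PercRepro2.Graph
import Summits.Ventures.PercRepro2.Events
import Summits.Ventures.PercRepro2.GateCylinder
import Summits.Ventures.PercRepro2.CDNestedInternal
import Summits.Ventures.PercRepro2.CDNestedRoutes

/-!
# The nested-routes theorem at the graph level: the simple paths of the graph (blind cell PercRepro2,
mine-a g35; MINE-A.md §90.5, proofs/MINEA-CD-NESTED.md §5)

The route hypothesis of `CDNestedRoutes.cd_of_nested_routes'` («every configuration with `a₁ ↮ a₂` and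
`a₁ ↔ a₃` has some route open») follows from a statement about the GRAPH alone: every simple `a₁–a₃`
path of the full graph (all edges open) that avoids `a₂` contains the edges of some route
(`route_of_paths`; the graph is simple: `ends` injective).  Proof: an open `a₁–a₃` walk is a walk of the
full graph; its bypass is a simple path whose support lies in the open walk's support, hence avoids
`a₂` (every vertex there is joined to `a₁`, and `a₁ ↮ a₂`); the route it contains has every edge on
the open walk, and by injectivity that open edge is the route's edge itself.  Hence
`cd_of_nested_paths`: routes with nested vertex sets, every simple `a₁–a₃` path avoiding `a₂` contains
one of them ⟹ row 2′CD for every up-set and every weight vector — the class NEST as a predicate of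
the graph and the three marks.  No definition; one seat.
-/

namespace Summit.Ventures.PercRepro2

namespace CDNestedPaths

section Paths

variable {V : Type*} {E : Type*} [DecidableEq V]

/-- **A simple-path hypothesis gives the route hypothesis**: if every simple `a₁–a₃` path of the full
graph avoiding `a₂` contains the edges of some route `B i`, then every configuration with `a₁ ↮ a₂`
and `a₁ ↔ a₃` has some route open (`ends` injective). -/
lemma route_of_paths {ends : E → Sym2 V} (hinj : Function.Injective ends) {a₁ a₂ a₃ : V} (k : ℕ)
    (B : ℕ → Finset E)
    (hpaths : ∀ W : (openGraph ends (fun _ => true)).Walk a₁ a₃, W.IsPath → a₂ ∉ W.support →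
      ∃ i, i < k ∧ ∀ b ∈ B i, ends b ∈ W.edges)
    (ω : Config E) (hQ : ¬ Conn ends ω a₁ a₂) (he : Conn ends ω a₁ a₃) :
    ∃ i, i < k ∧ ω ∈ GateCylinder.cylinder (B i) := by
  have he' : (openGraph ends ω).Reachable a₁ a₃ := he
  obtain ⟨W'⟩ := he'
  have hle : openGraph ends ω ≤ openGraph ends (fun _ => true) :=
    openGraph_mono fun e => Bool.le_true (ω e)
  set W := (W'.mapLe hle).bypass with hW
  have hpath : W.IsPath := SimpleGraph.Walk.bypass_isPath _
  have hsupp : a₂ ∉ W.support := by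
    intro ha
    have h1 := SimpleGraph.Walk.support_bypass_subset_support _ ha
    rw [SimpleGraph.Walk.support_mapLe_eq_support] at h1
    exact hQ (W'.takeUntil a₂ h1).reachable
  obtain ⟨i, hi, hB⟩ := hpaths W hpath hsupp
  refine ⟨i, hi, fun b hb => ?_⟩
  have hedge : ends b ∈ W'.edges := by
    have h1 := SimpleGraph.Walk.edges_bypass_subset_edges _ (hB b hb)
    rwa [SimpleGraph.Walk.edges_mapLe_eq_edges] at h1
  have key : ∀ z : Sym2 V, ends b = z → z ∈ W'.edges → ω b = true := by
    intro z
    induction z using Sym2.ind with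
    | h u v =>
      intro hz hmem
      have hadj := W'.adj_of_mem_edges hmem
      obtain ⟨_, e, hopen, hends⟩ := openGraph_adj.1 hadj
      have heb : e = b := hinj (hends.trans hz.symm)
      subst heb
      exact hopen
  exact key _ rfl hedge

end Paths

section Theorem

variable {V : Type*} {E : Type*} [Fintype E] [DecidableEq E] [Fintype V] [DecidableEq V]
  {R : Type*} [Field R] [LinearOrder R] [IsStrictOrderedRing R]

/-- **THE NESTED-ROUTES THEOREM AT THE GRAPH LEVEL.** Routes `L i` (`i < k`, walk-ordered from `a₁`,
reaching `a₃`) with nested vertex sets, in a simple graph (`ends` injective) in which every simple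
`a₁–a₃` path avoiding `a₂` contains the edges of some route.  Then row 2′CD holds for every `o`, every
up-set and every admissible weight vector. -/
theorem cd_of_nested_paths (p : E → R) (hp : IsProbVec p) {ends : E → Sym2 V}
    (hinj : Function.Injective ends) {a₁ a₂ a₃ o : V} (k : ℕ) (L : ℕ → List (E × V × V))
    (B : ℕ → Finset E) (S : ℕ → Finset V)
    (hB : ∀ i, i < k → B i = (L i).foldl (fun acc t => insert t.1 acc) (∅ : Finset E))
    (hS : ∀ i, i < k → S i = (L i).foldl (fun acc t => insert t.2.2 acc) ({a₁} : Finset V))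
    (hends : ∀ i, i < k → ∀ t ∈ L i, ends t.1 = s(t.2.1, t.2.2))
    (hwalk : ∀ i, i < k → ∀ j (hj : j < (L i).length), ((L i).get ⟨j, hj⟩).2.1 ∈
      ({a₁} : Finset V) ∪ (((L i).take j).map (fun u => u.2.2)).toFinset)
    (h3 : ∀ i, i < k → a₃ ∈ S i)
    (hnest : ∀ l i, l < i → i < k → S l ⊆ S i) {𝓔 : Set (Set V)} (h𝓔 : IsUpperSet 𝓔)
    (hpaths : ∀ W : (openGraph ends (fun _ => true)).Walk a₁ a₃, W.IsPath → a₂ ∉ W.support →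
      ∃ i, i < k ∧ ∀ b ∈ B i, ends b ∈ W.edges) :
    let Q := (connEvent ends a₁ a₂)ᶜ
    let U := clusterInEvent ends a₁ 𝓔
    let e := connEvent ends a₁ a₃
    let f := connEvent ends a₂ o
    let N := (connEvent ends a₁ a₃)ᶜ ∩ (connEvent ends a₂ a₃)ᶜ
    let oU := connEvent ends a₁ o ∪ connEvent ends a₂ o
    prob p (Q ∩ N) * (prob p Q * prob p (Q ∩ U ∩ e ∩ f) - prob p (Q ∩ U) * prob p (Q ∩ e ∩ f)) ≤
      prob p (Q ∩ N ∩ oU) * (prob p Q * prob p (Q ∩ U ∩ e) - prob p (Q ∩ U) * prob p (Q ∩ e)) :=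
  CDNestedRoutes.cd_of_nested_routes' p hp k L B S hB hS hends hwalk h3 hnest h𝓔
    (route_of_paths hinj k B hpaths)

end Theorem

end CDNestedPaths

end Summit.Ventures.PercRepro2
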